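import Literature.Geometry.Manifold.CompleteFlow
import Literature.Geometry.Lorentzian.KillingAlgebraAsymptoticallyFlatProofs
import Literature.Geometry.Lorentzian.DocStationarySpacetime
import Literature.Geometry.Lorentzian.KillingFieldOnNaturality
import HarnessLib

/-!
# The complete periodic flow of a local Killing field on an open connected invariant set

Let `g` be a `C^∞` pseudo-Riemannian metric (any signature) on a Hausdorff `C^∞` manifold `M`
modelled on `ℝ^d`, `W ⊆ M` open and connected, and `Z` a Killing field of `g` ON `W`
(`IsKillingFieldOn`, O'Neill 1983, Ch. 9, Def. 9.22 on the open submanifold `W`).  Assume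
COMPLETENESS INSIDE `W` — through every point of `W` there is a whole-line integral curve of `Z`
staying in `W` — and PERIODICITY ON A SAMPLE — through every point of some non-empty open `O ⊆ W`
such a curve which is `p`-periodic.  Then `Z` has a flow `Φ : ℝ → M → M` on `W`: `Φ 0 = id`,
`Φ s (W) ⊆ W`, the group law, `s ↦ Φ s x` an integral curve of `Z` for `x ∈ W`, and `Φ (s + p) = Φ s`
on ALL of `W` (`Φ s = id` off `W`).

* `IsKillingFieldOn.isKillingField_restrict` — read on the open sub-carrier `↥W`, `Z` is a GLOBAL
  Killing field of the restricted metric `g|W` (the restriction is the pullback along the inclusion,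
  `restrict_eq_comap`; Killing fields on open sets pull back, `IsKillingFieldOn.comap_mpullback`;
  O'Neill 1983, Ch. 3, p. 57 with Ch. 9, Prop. 9.25).  General form of step D of the crux
  `HawkingExtensionIsKerr` (`…RestrictTransport.lean`, there for presentations `𝓑`).
* `IsKillingFieldOn.exists_periodicFlow` — the theorem above.  Proof: on `↥W` the field is complete
  (integral curves of `Z` inside `W` are those of `Z|W`, `isMIntegralCurve_codRestrict`), so it has a
  global `C^∞` flow `θ` (fundamental theorem on flows, Lee 2013, Thm. 9.12,
  `Manifold.exists_contMDiff_globalFlow_of_complete`); `θₚ` fixes the points over `O` (uniqueness of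
  integral curves), hence is an isometric immersion of the connected `(↥W, g|W)` with identity 1-jet
  at a point, hence the identity (O'Neill 1983, Ch. 3, Prop. 3.62; `IsKillingField.flow_apply_eq_self_of_oneJet`)
  — the mechanism of Chruściel–Costa 2008, proof of Thm. 4.14 ("`φ_{2π}[K₍ᵢ₎]` is an isometry which
  is the identity on an open set near `𝓔⁺₀`, hence everywhere").

Everything here is proved; no definitions, no named facts.  Used by the crux
`NonTrappingHawkingRigidity` of the summit `FinalStateConjecture` (stub `stub_farAxialSeed`, the flow
of the continued axial Killing field).

## References
* B. O'Neill, *Semi-Riemannian geometry*, Academic Press 1983, Ch. 3, p. 57 and Prop. 3.62; Ch. 9,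
  Def. 9.22, Prop. 9.23, Prop. 9.25. [ONeillSemiRiemannian1983]
* J. M. Lee, *Introduction to Smooth Manifolds*, 2nd ed. (2013), Thm. 9.12. [LeeSmoothManifolds2013]
* P. T. Chruściel, J. L. Costa, Astérisque 321 (2008), arXiv:0806.0016, proof of Thm. 4.14. [ChruscielCosta2008]
-/

noncomputable section

open Set Filter Function Bundle TopologicalSpace VectorField Literature.Geometry.Manifold
open scoped Manifold ContDiff Topology

namespace Literature.Geometry.Lorentzian

namespace PseudoRiemannianMetric

universe u

variable {d : ℕ} {M : Type u} [TopologicalSpace M] [ChartedSpace (EuclideanSpace ℝ (Fin d)) M]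
  [IsManifold (𝓡 d) ∞ M] [T2Space M]
  {g : PseudoRiemannianMetric (𝓡 d) ∞ (EuclideanSpace ℝ (Fin d)) (TangentSpace (𝓡 d) : M → Type _)}
  [g.HasLeviCivita]

omit [T2Space M] in
/-- **A field Killing on an open set `W ⊇ U`, read on the open sub-carrier `U`, is a (global) Killing
field of `g|U`.**  `g|U = ι^* g` (`restrict_eq_comap`), `Z|U = ι^* Z` (`mpullback_subtypeVal`) and
Killing fields on an open set pull back (`IsKillingFieldOn.comap_mpullback`).  General form of
`Summit…HawkingExtensionIsKerr.SketchIdeator2.isKillingField_restrict_of_isKillingFieldOn`.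
O'Neill 1983, Ch. 9, Prop. 9.25 with Ch. 3, p. 57. [cite: ONeillSemiRiemannian1983, Ch. 9, Prop. 9.25] -/
theorem IsKillingFieldOn.isKillingField_restrict (U : Opens M)
    [(g.restrict PseudoRiemannianMetric.contMDiff_restrict_holds U).HasLeviCivita]
    {Z : Π x : M, TangentSpace (𝓡 d) x} {W : Set M} (hW : IsOpen W) (hUW : (U : Set M) ⊆ W)
    (hZ : g.IsKillingFieldOn Z W) :
    (g.restrict PseudoRiemannianMetric.contMDiff_restrict_holds U).IsKillingField
      (fun y : U ↦ (Z y.1 : TangentSpace (𝓡 d) y)) := by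
  set gc := g.comap PseudoRiemannianMetric.contMDiff_pullbackBilin_holds (Subtype.val : U → M)
    contMDiff_subtype_val (injective_mfderiv_subtypeVal U) rfl with hgc_def
  haveI hgcLC : gc.HasLeviCivita := gc.hasLeviCivita
  have hgc : g.restrict PseudoRiemannianMetric.contMDiff_restrict_holds U = gc :=
    PseudoRiemannianMetric.restrict_eq_comap g U
  have key : gc.IsKillingFieldOn (mpullback (𝓡 d) (𝓡 d) (Subtype.val : U → M) Z)
      ((Subtype.val : U → M) ⁻¹' W) :=
    PseudoRiemannianMetric.IsKillingFieldOn.comap_mpullback g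
      PseudoRiemannianMetric.contMDiff_pullbackBilin_holds contMDiff_subtype_val
      (injective_mfderiv_subtypeVal U) rfl hW hZ
  have huniv : ((Subtype.val : U → M) ⁻¹' W) = univ := eq_univ_of_forall fun y ↦ hUW y.2
  rw [mpullback_subtypeVal, huniv, PseudoRiemannianMetric.isKillingFieldOn_univ] at key
  exact (isKillingField_congr_metric hgc inferInstance hgcLC _).2 key

/-- **The complete `p`-periodic flow of a local Killing field on an open connected invariant set.**
Let `W` be open and connected, `Z` a Killing field of `g` on `W` such that through every `x ∈ W`
there is a whole-line integral curve of `Z` contained in `W`, and through every point of a non-empty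
open `O ⊆ W` such a curve which is moreover `p`-periodic.  Then there is `Φ : ℝ → M → M` with, for
`x ∈ W`: `Φ 0 x = x`, `Φ s x ∈ W`, `Φ (s + p) x = Φ s x`, `s ↦ Φ s x` an integral curve of `Z`, the group
law `Φ s (Φ t x) = Φ (s + t) x`; and `Φ s x = x` for `x ∉ W`.  Proof in the module docstring.
O'Neill 1983, Ch. 3, Prop. 3.62 and Ch. 9, Prop. 9.23; Lee 2013, Thm. 9.12; Chruściel–Costa 2008,
proof of Thm. 4.14. [cite: ChruscielCosta2008, Thm. 4.14 (proof)] -/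
theorem IsKillingFieldOn.exists_periodicFlow {W : Set M} (hWo : IsOpen W) (hWc : IsConnected W)
    {Z : Π x : M, TangentSpace (𝓡 d) x} (hZ : g.IsKillingFieldOn Z W)
    (hcomplete : ∀ x ∈ W, ∃ γ : ℝ → M, γ 0 = x ∧ IsMIntegralCurve γ Z ∧ ∀ s, γ s ∈ W)
    {p : ℝ} (hper : ∃ O : Set M, IsOpen O ∧ O.Nonempty ∧ O ⊆ W ∧
      ∀ x ∈ O, ∃ γ : ℝ → M, γ 0 = x ∧ IsMIntegralCurve γ Z ∧ (∀ s, γ s ∈ W) ∧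
        ∀ s, γ (s + p) = γ s) :
    ∃ Φ : ℝ → M → M,
      (∀ x ∈ W, Φ 0 x = x ∧ (∀ s : ℝ, Φ s x ∈ W) ∧ (∀ s : ℝ, Φ (s + p) x = Φ s x) ∧
        IsMIntegralCurve (fun s ↦ Φ s x) Z) ∧
      (∀ x ∈ W, ∀ s t : ℝ, Φ s (Φ t x) = Φ (s + t) x) ∧
      ∀ x, x ∉ W → ∀ s : ℝ, Φ s x = x := by
  classical
  set U : Opens M := ⟨W, hWo⟩ with hU
  haveI : ConnectedSpace U := isConnected_iff_connectedSpace.1 hWc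
  set gU := g.restrict PseudoRiemannianMetric.contMDiff_restrict_holds U with hgU
  haveI hLC : gU.HasLeviCivita := gU.hasLeviCivita
  set ZU : Π y : U, TangentSpace (𝓡 d) y := fun y ↦ (Z y.1 : TangentSpace (𝓡 d) y) with hZU_def
  -- `Z|W` is a global Killing field of `g|W`
  have hZU : gU.IsKillingField ZU := hZ.isKillingField_restrict U hWo Subset.rfl
  have hZUs : ContMDiff (𝓡 d) (𝓡 d).tangent ((⊤ : ℕ∞) : ℕ∞ω)
      (fun y : U ↦ (⟨y, ZU y⟩ : TangentBundle (𝓡 d) U)) := hZU.contMDiff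
  -- completeness on `↥W`
  have hcU : ∀ y : U, ∃ γ : ℝ → U, γ 0 = y ∧ IsMIntegralCurve γ ZU := by
    intro y
    obtain ⟨γ, h0, hγ, hW⟩ := hcomplete y.1 y.2
    exact ⟨fun t ↦ ⟨γ t, hW t⟩, Subtype.ext h0, isMIntegralCurve_codRestrict U hγ hW⟩
  -- the global flow on `↥W`
  obtain ⟨θ, hθs, hθ0, hθadd, hθZ⟩ :=
    exists_contMDiff_globalFlow_of_complete (I := 𝓡 d) (M := U) (n := (⊤ : ℕ∞)) hZUs le_top hcU
  -- `θₚ` fixes the points over `O`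
  obtain ⟨O, hOo, ⟨x₀, hx₀⟩, hOW, hOper⟩ := hper
  have h1 : ContMDiff (𝓡 d) (𝓡 d).tangent 1 (fun y : U ↦ (⟨y, ZU y⟩ : TangentBundle (𝓡 d) U)) :=
    hZUs.of_le (by exact_mod_cast le_top)
  have hfix : ∀ y : U, y.1 ∈ O → θ (p, y) = y := by
    intro y hy
    obtain ⟨γ, h0, hγ, hW, hγp⟩ := hOper y.1 hy
    set γU : ℝ → U := fun t ↦ ⟨γ t, hW t⟩ with hγU_def
    have hγU : IsMIntegralCurve γU ZU := isMIntegralCurve_codRestrict U hγ hW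
    have hγU0 : γU 0 = y := Subtype.ext h0
    have key := eq_flow_of_isMIntegralCurve h1 hθZ hθ0 hγU
    have hp : γU p = γU 0 := by
      apply Subtype.ext
      show γ p = γ 0
      simpa using hγp 0
    calc θ (p, y) = θ (p, γU 0) := by rw [hγU0]
      _ = γU p := (key p).symm
      _ = γU 0 := hp
      _ = y := hγU0
  -- hence `θₚ = id` on the connected `↥W` (isometry one-jet rigidity)
  set y₀ : U := ⟨x₀, hOW hx₀⟩ with hy₀
  have hev : (fun y : U ↦ θ (p, y)) =ᶠ[𝓝 y₀] id := by
    have hOU : IsOpen ((Subtype.val : U → M) ⁻¹' O) := hOo.preimage continuous_subtype_val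
    filter_upwards [hOU.mem_nhds (show y₀.1 ∈ O from hx₀)] with y hy using hfix y hy
  have hd : ∀ w : TangentSpace (𝓡 d) y₀, mfderiv (𝓡 d) (𝓡 d) (fun y : U ↦ θ (p, y)) y₀ w = w := by
    intro w
    rw [hev.mfderiv_eq, mfderiv_id]
    rfl
  have hall : ∀ y : U, θ (p, y) = y := fun y ↦
    hZU.flow_apply_eq_self_of_oneJet hθs hθ0 hθZ (hfix y₀ hx₀) hd y
  -- the flow on `M`
  refine ⟨fun s x ↦ if h : x ∈ W then ((θ (s, ⟨x, h⟩) : U) : M) else x, ?_, ?_, ?_⟩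
  · intro x hx
    refine ⟨?_, ?_, ?_, ?_⟩
    · simp only [dif_pos hx, hθ0]
    · intro s
      simp only [dif_pos hx]
      exact (θ (s, ⟨x, hx⟩)).2
    · intro s
      simp only [dif_pos hx]
      rw [← hθadd s p ⟨x, hx⟩, hall]
    · have heq : (fun s ↦ if h : x ∈ W then ((θ (s, ⟨x, h⟩) : U) : M) else x) =
          Subtype.val ∘ fun s ↦ θ (s, ⟨x, hx⟩) := by
        funext s
        simp only [dif_pos hx, comp_apply]
      rw [heq]
      exact (isMIntegralCurve_subtypeVal_comp_iff U).2 (hθZ ⟨x, hx⟩)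
  · intro x hx s t
    have hmem : ((θ (t, ⟨x, hx⟩) : U) : M) ∈ W := (θ (t, ⟨x, hx⟩)).2
    simp only [dif_pos hx, dif_pos hmem]
    rw [← hθadd s t ⟨x, hx⟩]
  · intro x hx s
    simp only [dif_neg hx]

end PseudoRiemannianMetric

end Literature.Geometry.Lorentzian

end
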